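import Mathlib
import Literature.Analysis.FunctionSpaces.LatticeConvolutionCommutator
import Literature.Analysis.FunctionSpaces.LatticeSymbolAlgebra
import Literature.Analysis.FluidPDE.SteadyNavierStokesRegularity
import Summits.NavierStokesRegularity.FluidComputer.ConvectiveProductLawLattice
import HarnessLib

/-!
# The transport term on the lattice Sobolev scale, I: the `H²` commutator and the first-slot bound (instab g16, cell `ns-blowup`, 2026-08-27)

HONEST FRAMING (human ruling D-0035): nothing here is a claim about Navier–Stokes blow-up.
WHAT THIS IS NOT: not NS evidence — lattice (`ℤ^d`, Fourier-side) inequalities between `ℝ≥0∞`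
sums, Mathlib + the tree's `Lattice*` toolkit (Warner GTM 94, 6.17–6.18 as typed in
`Literature/Analysis/FunctionSpaces/Lattice*.lean`) only. No flow, operator, set `W` or certificate
is constructed.

PURPOSE. The R-β emergence chain of the cell (`GalerkinEmergenceCertificate`, p470351) reaches the
TRUE (untruncated) system through the tree's Wilczak–Zgliczyński engine, whose condition (C2) for a
derivative-losing quadratic field was reduced in `GalerkinOneSidedLipschitz.galerkin_oneSided_uniform_transport`
(p472299) to three bounds on the set `W` of self-consistent bounds: `hA` (linear part, one-sided),
`hfirst` (`‖B(x − y, x)‖ ≤ c₁ ‖x − y‖`, the ADVECTING slot measured in the phase-space norm) and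
`htransport` (`⟪B(y, x − y), x − y⟫ ≤ κ ‖x − y‖²`). In the model instance (`HOME/instab/BETA2-SPEC.md`
§1–§5) the phase space is the `H²`-scaled `ℓ²` of Fourier coefficients and `B` is the transport
bilinearity `T_y x = ∑_j y_j ⋆ ∂_j x` (coefficients of `(y·∇)x`, then Leray-projected). This file
supplies the two NORM inequalities of that instance; the companion file `TransportSkewLattice.lean`
supplies the skew identity and the `H²` transport form (`htransport`).

CONTENTS (all proved, `0` definitions):
* §1 `abs_sobolevWeight_two_sub_le` — the kernel bound `|⟨k⟩₂ − ⟨l⟩₂| ≤ 3 ⟨k−l⟩₂ ⟨l⟩₁`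
  (`⟨k⟩₂ = 1 + |k|²`, `|k|² − |l|² = 2 l·(k−l) + |k−l|²`, Cauchy–Schwarz); the positive-order
  counterpart of the tree's `Torus.abs_sobolevWeight_neg_sub_le` (Warner 6.18 (17)).
* §2 `eNormSq_wmul_two_conv_sub_le`, `eNorm_wmul_two_conv_sub_le` — **the commutator `[Λ², a ⋆]`
  is of order one**: `‖Λ²(a ⋆ g) − a ⋆ (Λ² g)‖₀ ≤ 3 A₂(a) ‖g‖₁` for a rapidly decreasing symbol `a`
  and tempered `g` (`A₂ = Lattice.symbNorm 2`; Young `Lattice.young_sq`), same template as the tree's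
  negative-order `Lattice.eNorm_wmul_conv_sub_le`. Classical shape: Kato–Ponce / Calderón commutator.
* §3 `wmul_freqDeriv`, `wmul_finset_sum`, `toReal_eNorm_sq` — bookkeeping for `Λ^s`.
* §4 `eNormSq_two_le_of_transport_domination`, `enorm_transport_apply_le`,
  `eNormSq_two_transport_le` — **the first-slot bound**: if `|y_j(p)| ≤ ‖c p‖` then
  `‖T_y x‖₂² ≤ 4 (2π·card d)² A₃(x)² ‖c‖₂²`, `A₃(x) = ∑_l ⟨l⟩³ ‖x l‖` (Peetre `⟨k⟩² ≤ 2⟨k−l⟩²⟨l⟩²`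
  with the `ℓ¹` weight on the ADVECTED factor, then Young) — `hfirst` with
  `c₁ = 4π·card d·sup_W A₃` (finite on every polynomial box of order `s > 3 + d`), also the
  stretching half `‖ℙ[(d·∇)U]‖₂` of `hA`.

TREE SEARCH (`lean search`): lattice side — `Lattice.eNorm_conv_le` (Warner 6.18 (i): `ℓ¹` weight on
the factor at `k − l`, the wrong slot for `hfirst`), `Lattice.eNorm_wmul_conv_sub_le` (negative order
only), `ConvectiveProductLawLattice.eNormSq_one_le_of_convective_domination` (`H²·H² → H¹`, the `(B)`
constant `c_alg`); torus side (physical space, not imported): `Torus.integral_norm_laplacian_convect_self_sq_le`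
(`TorusConvectionLaplacianNormSq`, `‖Δ((u·∇)u)‖₂` by `H³`), the Constantin–E–Titi commutators
(`TorusCommutatorEstimate`, mollifier commutators — a different object). Reused: `ConvectiveProductLawLattice.sobolevWeight_one_eq_sqrt`,
`Literature.Analysis.FluidPDE.SteadyNS.sobolevWeight_two` (imported). Nothing restated.
-/

noncomputable section

namespace Summit.NavierStokesRegularity.FluidComputer.TransportCommutatorLattice

open Finset
open Literature.Analysis.FunctionSpaces Literature.Analysis.FunctionSpaces.Lattice
open Literature.Analysis.FunctionSpaces.Torus
open scoped ENNReal NNReal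

variable {d : Type*} [Fintype d]

/-! ## §1 The kernel bound `|⟨k⟩² − ⟨l⟩²| ≤ 3 ⟨k−l⟩² ⟨l⟩` -/

/-- `|k|² = |l|² + 2 l·(k−l) + |k−l|²` on `ℤ^d`. -/
theorem freqNormSq_eq_add_two_mul_sum_add (k l : d → ℤ) :
    freqNormSq k = freqNormSq l + 2 * ∑ i, (l i : ℝ) * ((k - l) i : ℝ) + freqNormSq (k - l) := by
  simp only [freqNormSq, Pi.sub_apply, Int.cast_sub, mul_sum, ← sum_add_distrib]
  exact sum_congr rfl fun i _ => by ring

/-- Cauchy–Schwarz against the brackets: `|l·m| ≤ ⟨l⟩ ⟨m⟩` on `ℤ^d`. -/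
theorem abs_sum_mul_le_sobolevWeight_mul (l m : d → ℤ) :
    |∑ i, (l i : ℝ) * (m i : ℝ)| ≤ sobolevWeight 1 l * sobolevWeight 1 m := by
  have hcs : (∑ i, (l i : ℝ) * (m i : ℝ)) ^ 2 ≤ (∑ i, (l i : ℝ) ^ 2) * ∑ i, (m i : ℝ) ^ 2 :=
    sum_mul_sq_le_sq_mul_sq univ _ _
  calc |∑ i, (l i : ℝ) * (m i : ℝ)| ≤ Real.sqrt ((∑ i, (l i : ℝ) ^ 2) * ∑ i, (m i : ℝ) ^ 2) :=
        Real.abs_le_sqrt hcs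
    _ = Real.sqrt (freqNormSq l) * Real.sqrt (freqNormSq m) := by
        rw [Real.sqrt_mul (sum_nonneg fun i _ => sq_nonneg _)]; rfl
    _ ≤ sobolevWeight 1 l * sobolevWeight 1 m := by
        rw [ConvectiveProductLawLattice.sobolevWeight_one_eq_sqrt,
          ConvectiveProductLawLattice.sobolevWeight_one_eq_sqrt]
        exact mul_le_mul (Real.sqrt_le_sqrt (by linarith)) (Real.sqrt_le_sqrt (by linarith))
          (Real.sqrt_nonneg _) (Real.sqrt_nonneg _)

/-- **The kernel bound of the order-two commutator**: `|⟨k⟩₂ − ⟨l⟩₂| ≤ 3 ⟨k − l⟩₂ ⟨l⟩₁`, i.e.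
`||k|² − |l|²| = |2 l·(k−l) + |k−l|²| ≤ 2⟨l⟩⟨k−l⟩ + ⟨k−l⟩² ≤ 3 ⟨k−l⟩² ⟨l⟩` (all brackets are `≥ 1`).
This is the positive-order counterpart of the tree's `Torus.abs_sobolevWeight_neg_sub_le`
(Warner 6.18 (17), negative order): the commutator of `Λ²` with a multiplier costs two weights on
the multiplier and ONE on the argument. -/
theorem abs_sobolevWeight_two_sub_le (k l : d → ℤ) :
    |sobolevWeight 2 k - sobolevWeight 2 l| ≤ 3 * sobolevWeight 2 (k - l) * sobolevWeight 1 l := by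
  have h1l : 1 ≤ sobolevWeight 1 l := one_le_sobolevWeight zero_le_one l
  have h1kl : 1 ≤ sobolevWeight 1 (k - l) := one_le_sobolevWeight zero_le_one (k - l)
  have h12 : sobolevWeight 1 (k - l) ≤ sobolevWeight 2 (k - l) := sobolevWeight_mono (by norm_num) _
  have h2kl : 0 ≤ sobolevWeight 2 (k - l) := (sobolevWeight_pos _ _).le
  have hcs := abs_sum_mul_le_sobolevWeight_mul l (k - l)
  have hdiff : sobolevWeight 2 k - sobolevWeight 2 l =
      2 * ∑ i, (l i : ℝ) * ((k - l) i : ℝ) + freqNormSq (k - l) := by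
    rw [Literature.Analysis.FluidPDE.SteadyNS.sobolevWeight_two,
      Literature.Analysis.FluidPDE.SteadyNS.sobolevWeight_two, freqNormSq_eq_add_two_mul_sum_add k l]
    ring
  have hfr : freqNormSq (k - l) ≤ sobolevWeight 2 (k - l) := by
    rw [Literature.Analysis.FluidPDE.SteadyNS.sobolevWeight_two]; linarith
  rw [hdiff]
  calc |2 * ∑ i, (l i : ℝ) * ((k - l) i : ℝ) + freqNormSq (k - l)|
      ≤ |2 * ∑ i, (l i : ℝ) * ((k - l) i : ℝ)| + |freqNormSq (k - l)| := abs_add_le _ _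
    _ = 2 * |∑ i, (l i : ℝ) * ((k - l) i : ℝ)| + freqNormSq (k - l) := by
        rw [abs_mul, abs_two, abs_of_nonneg (freqNormSq_nonneg _)]
    _ ≤ 2 * (sobolevWeight 1 l * sobolevWeight 1 (k - l)) + sobolevWeight 2 (k - l) := by
        gcongr
    _ ≤ 2 * (sobolevWeight 1 l * sobolevWeight 2 (k - l)) + sobolevWeight 2 (k - l) * sobolevWeight 1 l := by
        gcongr
        · exact le_mul_of_one_le_right h2kl h1l
    _ = 3 * sobolevWeight 2 (k - l) * sobolevWeight 1 l := by ring

/-! ## §2 The commutator `[Λ², a ⋆]` is an operator of order one: `‖Λ²(a ⋆ g) − a ⋆ (Λ² g)‖₀ ≤ 3 A₂(a) ‖g‖₁` -/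

section Commutator

variable {V W : Type*} [NormedAddCommGroup V] [NormedSpace ℂ V] [NormedAddCommGroup W]
  [NormedSpace ℂ W]

/-- **The `H²` commutator estimate, squared form**: for a rapidly decreasing symbol `a` and a
tempered family `g`, `‖Λ²(a ⋆ g) − a ⋆ (Λ² g)‖₀² ≤ 9 A₂(a)² ‖g‖₁²` with `A₂(a) = ∑_k ⟨k⟩² ‖a k‖`
(`Lattice.symbNorm 2 a`) — termwise kernel bound `abs_sobolevWeight_two_sub_le` and Young's
inequality `Lattice.young_sq`, exactly as in the tree's negative-order
`Lattice.eNorm_wmul_conv_sub_le` (Warner 6.18 (17)). Classical (Kato–Ponce / Calderón commutator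
shape on the torus); recorded here in the lattice vocabulary of the R-β chain. -/
theorem eNormSq_wmul_two_conv_sub_le [CompleteSpace W] {a : (d → ℤ) → (V →L[ℂ] W)}
    (ha : RapidDecay a) {g : (d → ℤ) → V} (hg : Tempered g) :
    eNormSq 0 (wmul 2 (conv a g) - conv a (wmul 2 g)) ≤ 9 * (symbNorm 2 a ^ 2 * eNormSq 1 g) := by
  obtain ⟨α, hα⟩ : ∃ α : (d → ℤ) → ℝ≥0∞, ∀ k, α k = ENNReal.ofReal (sobolevWeight 2 k * ‖a k‖) :=
    ⟨_, fun _ => rfl⟩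
  obtain ⟨β, hβ⟩ : ∃ β : (d → ℤ) → ℝ≥0∞, ∀ l, β l = ENNReal.ofReal (sobolevWeight 1 l * ‖g l‖) :=
    ⟨_, fun _ => rfl⟩
  -- termwise bound
  have hterm : ∀ k, ‖(wmul 2 (conv a g) - conv a (wmul 2 g)) k‖ₑ ≤ 3 * ∑' l, α (k - l) * β l := by
    intro k
    rw [wmul_conv_sub_conv_wmul_apply ha hg]
    refine enorm_tsum_le_tsum_enorm.trans ?_
    rw [← ENNReal.tsum_mul_left]
    refine ENNReal.tsum_le_tsum fun l => ?_
    rw [enorm_smul, ← ofReal_norm, ← ofReal_norm (a (k - l) (g l)), Complex.norm_real,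
      Real.norm_eq_abs]
    have hb := abs_sobolevWeight_two_sub_le k l
    have hA0 : 0 ≤ sobolevWeight 2 (k - l) * ‖a (k - l)‖ := by
      positivity [sobolevWeight_pos 2 (k - l)]
    have h1 : 0 ≤ 3 * sobolevWeight 2 (k - l) * sobolevWeight 1 l := by
      positivity [sobolevWeight_pos 2 (k - l), sobolevWeight_pos 1 l]
    calc ENNReal.ofReal |sobolevWeight 2 k - sobolevWeight 2 l| * ENNReal.ofReal ‖a (k - l) (g l)‖
        ≤ ENNReal.ofReal (3 * sobolevWeight 2 (k - l) * sobolevWeight 1 l) *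
            ENNReal.ofReal (‖a (k - l)‖ * ‖g l‖) :=
          mul_le_mul' (ENNReal.ofReal_le_ofReal hb)
            (ENNReal.ofReal_le_ofReal ((a (k - l)).le_opNorm _))
      _ = 3 * (α (k - l) * β l) := by
          rw [hα, hβ, ← ENNReal.ofReal_mul hA0, ← ENNReal.ofReal_mul h1,
            show (3 : ℝ≥0∞) = ENNReal.ofReal 3 by norm_num, ← ENNReal.ofReal_mul (by norm_num)]
          congr 1
          ring
  -- identify `∑ α` and `∑ β²`
  have hαsum : ∑' k, α k = symbNorm 2 a := tsum_congr fun k => by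
    rw [hα, ENNReal.ofReal_mul (sobolevWeight_pos _ _).le, ofReal_norm]
  have hβsum : ∑' l, β l ^ 2 = eNormSq 1 g := tsum_congr fun l => by
    rw [hβ, ← ENNReal.ofReal_pow (by positivity [sobolevWeight_pos 1 l]), mul_pow,
      ENNReal.ofReal_mul (sq_nonneg _), ← ofReal_norm, ENNReal.ofReal_pow (norm_nonneg _)]
  calc eNormSq 0 (wmul 2 (conv a g) - conv a (wmul 2 g))
      = ∑' k, ‖(wmul 2 (conv a g) - conv a (wmul 2 g)) k‖ₑ ^ 2 := by simp [eNormSq]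
    _ ≤ ∑' k, (3 * ∑' l, α (k - l) * β l) ^ 2 := ENNReal.tsum_le_tsum fun k => by
        gcongr; exact hterm k
    _ = 9 * ∑' k, (∑' l, α (k - l) * β l) ^ 2 := by
        simp only [mul_pow]; rw [ENNReal.tsum_mul_left]; norm_num
    _ ≤ 9 * ((∑' k, α k) ^ 2 * ∑' l, β l ^ 2) := by gcongr; exact young_sq α β
    _ = 9 * (symbNorm 2 a ^ 2 * eNormSq 1 g) := by rw [hαsum, hβsum]

/-- **The `H²` commutator estimate**: `‖Λ²(a ⋆ g) − a ⋆ (Λ² g)‖₀ ≤ 3 A₂(a) ‖g‖₁` for a rapidly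
decreasing symbol `a` and a tempered family `g`. -/
theorem eNorm_wmul_two_conv_sub_le [CompleteSpace W] {a : (d → ℤ) → (V →L[ℂ] W)}
    (ha : RapidDecay a) {g : (d → ℤ) → V} (hg : Tempered g) :
    eNorm 0 (wmul 2 (conv a g) - conv a (wmul 2 g)) ≤ 3 * symbNorm 2 a * eNorm 1 g := by
  have h := eNormSq_wmul_two_conv_sub_le ha hg
  have h9 : (9 : ℝ≥0∞) = 3 ^ 2 := by norm_num
  rw [h9, ← mul_assoc, ← mul_pow] at h
  calc eNorm 0 (wmul 2 (conv a g) - conv a (wmul 2 g))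
      = (eNormSq 0 (wmul 2 (conv a g) - conv a (wmul 2 g))) ^ (1 / 2 : ℝ) := rfl
    _ ≤ ((3 * symbNorm 2 a) ^ 2 * eNormSq 1 g) ^ (1 / 2 : ℝ) := by gcongr
    _ = 3 * symbNorm 2 a * eNorm 1 g := by
        rw [ENNReal.mul_rpow_of_nonneg _ _ (by norm_num), ennreal_sq_rpow_half, eNorm]

end Commutator


/-! ## §3 Bookkeeping for the weight multipliers `Λ^s` -/

section WmulAlgebra

variable {X : Type*} [NormedAddCommGroup X] [NormedSpace ℂ X]

/-- `Λ^s` commutes with `∂_j` (both are scalar multipliers). -/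
theorem wmul_freqDeriv (s : ℝ) (j : d) (c : (d → ℤ) → X) :
    wmul s (freqDeriv j c) = freqDeriv j (wmul s c) := by
  funext k
  simp only [wmul_apply, freqDeriv_apply, smul_smul, mul_comm]

/-- `Λ^s` is additive over finite sums. -/
theorem wmul_finset_sum {ι : Type*} (F : Finset ι) (s : ℝ) (c : ι → (d → ℤ) → X) :
    wmul s (∑ i ∈ F, c i) = ∑ i ∈ F, wmul s (c i) := by
  funext k
  simp only [wmul_apply, Finset.sum_apply, Finset.smul_sum]

omit [NormedSpace ℂ X] in
/-- `‖u‖ₛ² = ‖u‖²ₛ` on the real side: `(eNorm s u).toReal ^ 2 = (eNormSq s u).toReal`. -/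
theorem toReal_eNorm_sq (s : ℝ) (u : (d → ℤ) → X) :
    (eNorm s u).toReal ^ 2 = (eNormSq s u).toReal := by
  rw [← ENNReal.toReal_pow, eNorm_pow_two]

end WmulAlgebra

/-! ## §4 The first-slot bound: `‖T_c x‖₂ ≤ 4π·(card d)·A₃(x)·‖c‖₂` (the advecting field in `H²`, the target in a weighted `ℓ¹`) -/

section FirstSlot

variable {E' F' G' : Type*} [NormedAddCommGroup E'] [NormedAddCommGroup F'] [NormedAddCommGroup G']

/-- **Young + Peetre with the `ℓ¹` weight on the ADVECTED factor**: if a family `f` is dominated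
by the transport-type convolution `‖f k‖ ≤ C ∑_l ‖c(k−l)‖ ⟨l⟩ ‖x l‖` (one derivative on `x`), then
`‖f‖₂² ≤ 4 C² A₃(x)² ‖c‖₂²` with `A₃(x) = ∑_l ⟨l⟩³ ‖x l‖` — Peetre `⟨k⟩² ≤ 2⟨k−l⟩²⟨l⟩²` puts
`⟨k−l⟩²` on the `ℓ²` factor `c` and `⟨l⟩²·⟨l⟩ = ⟨l⟩³` on the `ℓ¹` factor `x`, then
`Lattice.young_sq`. Contrast `Lattice.eNormSq_le_of_enorm_le_conv` (Warner 6.18 (i)), where the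
`ℓ¹` weight sits on the factor at `k − l`: here the roles are swapped because the FIRST slot of the
transport term (the advecting field) is the one measured in `H²`. -/
theorem eNormSq_two_le_of_transport_domination (c : (d → ℤ) → E') (x : (d → ℤ) → F')
    {f : (d → ℤ) → G'} (C : ℝ≥0∞)
    (hdom : ∀ k, ‖f k‖ₑ ≤ C * ∑' l, ‖c (k - l)‖ₑ * (ENNReal.ofReal (sobolevWeight 1 l) * ‖x l‖ₑ)) :
    eNormSq 2 f ≤ 4 * C ^ 2 * (∑' l, ENNReal.ofReal (sobolevWeight 3 l) * ‖x l‖ₑ) ^ 2 *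
      eNormSq 2 c := by
  obtain ⟨α, hα⟩ : ∃ α : (d → ℤ) → ℝ≥0∞, ∀ l, α l = ENNReal.ofReal (sobolevWeight 3 l) * ‖x l‖ₑ :=
    ⟨_, fun _ => rfl⟩
  obtain ⟨β, hβ⟩ : ∃ β : (d → ℤ) → ℝ≥0∞, ∀ l, β l = ENNReal.ofReal (sobolevWeight 2 l) * ‖c l‖ₑ :=
    ⟨_, fun _ => rfl⟩
  have hpeetre : ∀ k l : d → ℤ, sobolevWeight 2 k ≤ 2 * sobolevWeight 2 (k - l) * sobolevWeight 2 l :=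
    fun k l => by
      have h := sobolevWeight_le_peetre_of_nonneg (by norm_num : (0 : ℝ) ≤ 2) k l
      rwa [show (2 : ℝ) / 2 = 1 by norm_num, Real.rpow_one] at h
  have h3 : ∀ l : d → ℤ, sobolevWeight 2 l * sobolevWeight 1 l = sobolevWeight 3 l := fun l => by
    rw [← sobolevWeight_add]; norm_num
  -- termwise bound
  have hterm : ∀ k, ENNReal.ofReal (sobolevWeight 2 k) * ‖f k‖ₑ ≤ 2 * C * ∑' l, α (k - l) * β l := by
    intro k
    have hswap : ∑' l, β (k - l) * α l = ∑' l, α (k - l) * β l := by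
      calc ∑' l, β (k - l) * α l = ∑' l, (fun m => α m * β (k - m)) l :=
            tsum_congr fun l => mul_comm _ _
        _ = ∑' l, (fun m => α m * β (k - m)) (k - l) :=
            (tsum_sub_left_eq (fun m => α m * β (k - m)) k).symm
        _ = ∑' l, α (k - l) * β l := tsum_congr fun l => by simp only [sub_sub_cancel]
    calc ENNReal.ofReal (sobolevWeight 2 k) * ‖f k‖ₑ
        ≤ ENNReal.ofReal (sobolevWeight 2 k) *
            (C * ∑' l, ‖c (k - l)‖ₑ * (ENNReal.ofReal (sobolevWeight 1 l) * ‖x l‖ₑ)) := by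
          gcongr; exact hdom k
      _ = C * ∑' l, ENNReal.ofReal (sobolevWeight 2 k) *
            (‖c (k - l)‖ₑ * (ENNReal.ofReal (sobolevWeight 1 l) * ‖x l‖ₑ)) := by
          rw [ENNReal.tsum_mul_left]; ring
      _ ≤ C * ∑' l, ENNReal.ofReal (2 * sobolevWeight 2 (k - l) * sobolevWeight 2 l) *
            (‖c (k - l)‖ₑ * (ENNReal.ofReal (sobolevWeight 1 l) * ‖x l‖ₑ)) := by
          gcongr with l; exact hpeetre k l
      _ = C * ∑' l, 2 * (β (k - l) * α l) := by
          congr 1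
          refine tsum_congr fun l => ?_
          rw [hβ, hα, ← h3 l, ENNReal.ofReal_mul (by positivity [sobolevWeight_pos 2 (k - l)]),
            ENNReal.ofReal_mul (by norm_num), ENNReal.ofReal_mul (sobolevWeight_pos 2 l).le,
            show ENNReal.ofReal (2 : ℝ) = 2 by norm_num]
          ring
      _ = 2 * C * ∑' l, α (k - l) * β l := by rw [ENNReal.tsum_mul_left, hswap]; ring
  -- square and sum
  have hα' : ∑' l, ENNReal.ofReal (sobolevWeight 3 l) * ‖x l‖ₑ = ∑' l, α l :=
    tsum_congr fun l => (hα l).symm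
  have hβ2 : ∑' l, β l ^ 2 = eNormSq 2 c := tsum_congr fun l => by
    rw [hβ, mul_pow, ENNReal.ofReal_pow (sobolevWeight_pos _ _).le]
  rw [hα']
  calc eNormSq 2 f = ∑' k, (ENNReal.ofReal (sobolevWeight 2 k) * ‖f k‖ₑ) ^ 2 :=
        tsum_congr fun k => by rw [mul_pow, ENNReal.ofReal_pow (sobolevWeight_pos _ _).le]
    _ ≤ ∑' k, (2 * C * ∑' l, α (k - l) * β l) ^ 2 := ENNReal.tsum_le_tsum fun k => by
        gcongr ?_ ^ 2; exact hterm k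
    _ = (2 * C) ^ 2 * ∑' k, (∑' l, α (k - l) * β l) ^ 2 := by
        rw [← ENNReal.tsum_mul_left]
        exact tsum_congr fun k => by rw [mul_pow]
    _ ≤ (2 * C) ^ 2 * ((∑' l, α l) ^ 2 * ∑' l, β l ^ 2) := by gcongr; exact young_sq α β
    _ = 4 * C ^ 2 * (∑' l, α l) ^ 2 * eNormSq 2 c := by rw [hβ2]; ring

variable {V : Type*} [NormedAddCommGroup V] [NormedSpace ℂ V]

/-- **Domination of the transport family by the advecting field**: if the component families
`y_j` of the advecting field are dominated by one family `c` (`|y_j(p)| ≤ ‖c p‖`, e.g. `y_j = π_j ∘ c`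
for norm-one coordinate functionals), then termwise
`‖(T_y x)(k)‖ ≤ 2π·(card d)·∑_l ‖c(k−l)‖ ⟨l⟩ ‖x l‖` (`T_y x = ∑_j y_j ⋆ ∂_j x`; unconditional,
`ℝ≥0∞`-valued sums). -/
theorem enorm_transport_apply_le (y : d → (d → ℤ) → ℂ) (c : (d → ℤ) → E')
    (hyc : ∀ j p, ‖y j p‖ ≤ ‖c p‖) (x : (d → ℤ) → V) (k : d → ℤ) :
    ‖(∑ j, conv (scal (y j)) (freqDeriv j x)) k‖ₑ ≤
      (Fintype.card d : ℝ≥0∞) * ENNReal.ofReal (2 * Real.pi) *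
        ∑' l, ‖c (k - l)‖ₑ * (ENNReal.ofReal (sobolevWeight 1 l) * ‖x l‖ₑ) := by
  have hj : ∀ j, ‖conv (scal (y j) : (d → ℤ) → (V →L[ℂ] V)) (freqDeriv j x) k‖ₑ ≤
      ENNReal.ofReal (2 * Real.pi) *
        ∑' l, ‖c (k - l)‖ₑ * (ENNReal.ofReal (sobolevWeight 1 l) * ‖x l‖ₑ) := by
    intro j
    refine (enorm_conv_apply_le _ _ k).trans ?_
    rw [← ENNReal.tsum_mul_left]
    refine ENNReal.tsum_le_tsum fun l => ?_
    have h1 : ‖(scal (y j) : (d → ℤ) → (V →L[ℂ] V)) (k - l)‖ₑ ≤ ‖c (k - l)‖ₑ := by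
      rw [← ofReal_norm, ← ofReal_norm, scal_apply, ContinuousLinearMap.one_def, norm_smul]
      refine ENNReal.ofReal_le_ofReal ?_
      calc ‖y j (k - l)‖ * ‖ContinuousLinearMap.id ℂ V‖ ≤ ‖y j (k - l)‖ * 1 :=
            mul_le_mul_of_nonneg_left ContinuousLinearMap.norm_id_le (norm_nonneg _)
        _ ≤ ‖c (k - l)‖ := by rw [mul_one]; exact hyc j (k - l)
    have h2 : ‖freqDeriv j x l‖ₑ ≤ ENNReal.ofReal (2 * Real.pi) *
        (ENNReal.ofReal (sobolevWeight 1 l) * ‖x l‖ₑ) := by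
      rw [← ofReal_norm, ← ofReal_norm, norm_freqDeriv_apply,
        ← ENNReal.ofReal_mul (sobolevWeight_pos 1 l).le, ← ENNReal.ofReal_mul (by positivity)]
      refine ENNReal.ofReal_le_ofReal ?_
      have h := mul_le_mul_of_nonneg_right (abs_apply_le_sobolevWeight_one l j) (norm_nonneg (x l))
      calc 2 * Real.pi * |(l j : ℝ)| * ‖x l‖ = 2 * Real.pi * (|(l j : ℝ)| * ‖x l‖) := by ring
        _ ≤ 2 * Real.pi * (sobolevWeight 1 l * ‖x l‖) :=
            mul_le_mul_of_nonneg_left h (by positivity)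
    calc ‖(scal (y j) : (d → ℤ) → (V →L[ℂ] V)) (k - l)‖ₑ * ‖freqDeriv j x l‖ₑ
        ≤ ‖c (k - l)‖ₑ * (ENNReal.ofReal (2 * Real.pi) *
            (ENNReal.ofReal (sobolevWeight 1 l) * ‖x l‖ₑ)) := mul_le_mul' h1 h2
      _ = _ := by ring
  calc ‖(∑ j, conv (scal (y j)) (freqDeriv j x)) k‖ₑ
      = ‖∑ j, conv (scal (y j) : (d → ℤ) → (V →L[ℂ] V)) (freqDeriv j x) k‖ₑ := by
        rw [Finset.sum_apply]
    _ ≤ ∑ j, ‖conv (scal (y j) : (d → ℤ) → (V →L[ℂ] V)) (freqDeriv j x) k‖ₑ := enorm_sum_le _ _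
    _ ≤ ∑ _j : d, ENNReal.ofReal (2 * Real.pi) *
          ∑' l, ‖c (k - l)‖ₑ * (ENNReal.ofReal (sobolevWeight 1 l) * ‖x l‖ₑ) :=
        Finset.sum_le_sum fun j _ => hj j
    _ = _ := by rw [Finset.sum_const, Finset.card_univ, nsmul_eq_mul, mul_assoc]

/-- **The first-slot bound** (the `hfirst`-shaped input of condition (C2) for the R-β chain): with
the advecting field measured in `H²` and the advected target in the weighted `ℓ¹` norm
`A₃(x) = ∑_l ⟨l⟩³ ‖x l‖` (finite on every polynomial box of order `s > 3 + d`),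
`‖T_y x‖₂² ≤ 4 (2π card d)² A₃(x)² ‖c‖₂²` whenever `|y_j(p)| ≤ ‖c p‖`. -/
theorem eNormSq_two_transport_le (y : d → (d → ℤ) → ℂ) (c : (d → ℤ) → E')
    (hyc : ∀ j p, ‖y j p‖ ≤ ‖c p‖) (x : (d → ℤ) → V) :
    eNormSq 2 (∑ j, conv (scal (y j)) (freqDeriv j x)) ≤
      4 * ((Fintype.card d : ℝ≥0∞) * ENNReal.ofReal (2 * Real.pi)) ^ 2 *
        (∑' l, ENNReal.ofReal (sobolevWeight 3 l) * ‖x l‖ₑ) ^ 2 * eNormSq 2 c :=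
  eNormSq_two_le_of_transport_domination c x _ fun k => enorm_transport_apply_le y c hyc x k

end FirstSlot

end Summit.NavierStokesRegularity.FluidComputer.TransportCommutatorLattice

end
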